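import Summits.QuantumAdvantage.QuantumAdvantage.Theorems.NearExactIsExact.Negative.MmPairFixedPoints
import Summits.QuantumAdvantage.QuantumAdvantage.Theorems.CubicForrelationNearExactIsExactMmFormCeilingA
import Summits.QuantumAdvantage.QuantumAdvantage.Theorems.CubicForrelationNearExactIsExactRothausB
import Summits.QuantumAdvantage.QuantumAdvantage.Theorems.CubicForrelationNearExactIsExactBentDuality

/-!
# Crux `CubicForrelation.NearExactIsExact` (stmt-QuantumAdvantage-14043) — the UNIFORM `15/16` gap for two-sided Maiorana–McFarland pairs
  with quadratic maps, at EVERY `n = 2m`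

Certificate seat `b2b-cforr-cert` (gen 6).  HONEST FRAMING: a theorem, uniform in `n`, about the structured class in which all known
record values of the crux live (the `15/16` witness on 16 bits, the `57/64` records on 12 and 14 bits); it decides `NearExactIsExact` with
`θ = 15/16` INSIDE the non-bijective part of this class and reduces the bijective part to a coding question — NOT summit progress (the crux
quantifies over all cubic pairs).

Setting (`Negative/MmPairFixedPoints.lean`, disprover seat g2): both functions in Maiorana–McFarland sign form for the same split `m + m`,
`(−1)^{g(y₁‖y₂)} = (−1)^{y₁·π(y₂)}(−1)^{h(y₂)}`, `(−1)^{f(x₁‖x₂)} = (−1)^{x₂·τ(x₁)}(−1)^{r(x₁)}`, so `Φ(f,g) = 2^{−m}Σ_{y : τ(π y) = y} ±1`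
(`forrelation_mmPair`).  NEW here: if the maps `π, τ : 𝔽₂^m → 𝔽₂^m` have coordinates of algebraic degree `≤ 2` (which is what makes `f, g`
cubic), then every coordinate of `y ↦ τ(π(y)) ⊕ y` has degree `≤ 4` (`fc_isDegLeFun_comp`), hence is `≡ 0` or non-zero on `≥ 2^{m−4}` points
(Reed–Muller).  Therefore (`mg_mmPair_gap`): **if `τ ∘ π ≠ id` then `|Φ(f,g)| ≤ 15/16`, for every `m`** — and (`mg_mmPair_dichotomy`)
`Φ(f,g) > 15/16` forces `τ ∘ π = id` and `Φ = 1 − 2·#{y : h(y) ≠ r(π y)}/2^m` (`mg_mmPair_near_exact`).  `15/16` is attained at `m = 8`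
(`Negative/FifteenSixteenths.lean`).  The bijective remainder ("BQQ": minimum distance of `RM(3,m) + RM(3,m)∘π` for biquadratic `π`) is
settled in the tree only for `m = 7` (`Negative/BqqSeven.lean`, value `7/8`) and is open in general; but the crude Reed–Muller bound on the
degree-`≤ 6` word `h ⊕ r∘π` already gives `mg_mmPair_isolation`: **`Φ = 1 ∨ Φ ≤ 31/32` for every two-sided MM pair with quadratic maps and
cubic offsets, at every `n`** — `NearExactIsExact` holds uniformly on this structured class.

References: R. L. McFarland, JCTA 15 (1973); C. Carlet, *Boolean Functions for Cryptography and Coding Theory* (2021) §6.1, §4.1;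
MacWilliams–Sloane (1977) Ch. 13.  Everything below is proved from Mathlib and the tree; axioms are the standard three.
-/

set_option linter.dupNamespace false -- D-0017: single-problem summit ⇒ `QuantumAdvantage.QuantumAdvantage` by design

noncomputable section

namespace Summit.QuantumAdvantage.QuantumAdvantage.Theorems.CubicForrelation.NearExactIsExact

open Finset
open Literature.Computability.QuantumComplexity
open Summit.QuantumAdvantage.QuantumAdvantage.Theorems.NearExactIsExact.Negative.MmPairFixedPoints
  (forrelation_mmPair abs_forrelation_mmPair_le forrelation_mmPair_of_leftInverse)

variable {m : ℕ}

/-- A coordinate of `y ↦ τ(π(y)) ⊕ y` has degree `≤ 4` when `π` and `τ` have quadratic coordinates. [cite: Carlet2020, §2.2.1] -/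
theorem mg_deg_fix_coord (π τ : (Fin m → Bool) → (Fin m → Bool)) (hπ : ∀ i, IsDegLeFun 2 (fun y => π y i))
    (hτ : ∀ i, IsDegLeFun 2 (fun x => τ x i)) (i : Fin m) : IsDegLeFun 4 (fun y => τ (π y) i ^^ y i) := by
  have hcomp : IsDegLeFun 4 (fun y => τ (π y) i) := fc_isDegLeFun_comp (hτ i) π hπ (by norm_num)
  exact bb_isDegLeFun_bxor hcomp ((isDegLeFun_apply i (by norm_num : 1 ≤ 4)))

/-- **The uniform `15/16` gap for non-bijective two-sided Maiorana–McFarland pairs.**  For EVERY `m`: if `f, g : 𝔽₂^{m+m} → 𝔽₂` are in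
two-sided MM sign form with maps `π, τ` whose coordinates have degree `≤ 2`, and `τ ∘ π ≠ id`, then `|Φ(f,g)| ≤ 15/16`.
(Fixed-point formula + Reed–Muller: a non-zero coordinate of `τ∘π ⊕ id` has degree `≤ 4`, so at least `2^{m−4}` points are not fixed.)
[this work] -/
theorem mg_mmPair_gap (f g : (Fin (m + m) → Bool) → Bool) (π τ : (Fin m → Bool) → (Fin m → Bool)) (h r : (Fin m → Bool) → Bool)
    (hg : ∀ y₁ y₂ : Fin m → Bool, signOf (g (Fin.append y₁ y₂)) = twist y₁ (π y₂) * signOf (h y₂))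
    (hf : ∀ x₁ x₂ : Fin m → Bool, signOf (f (Fin.append x₁ x₂)) = twist x₂ (τ x₁) * signOf (r x₁))
    (hπ : ∀ i, IsDegLeFun 2 (fun y => π y i)) (hτ : ∀ i, IsDegLeFun 2 (fun x => τ x i))
    (hne : ∃ y₂, τ (π y₂) ≠ y₂) : |forrelation f g| ≤ 15 / 16 := by
  classical
  obtain ⟨y₀, hy₀⟩ := hne
  obtain ⟨i, hi⟩ : ∃ i, τ (π y₀) i ≠ y₀ i := by
    by_contra hall
    push Not at hall
    exact hy₀ (funext hall)
  have hdeg := mg_deg_fix_coord π τ hπ hτ i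
  have hD0 : (τ (π y₀) i ^^ y₀ i) = true := by
    revert hi; cases τ (π y₀) i <;> cases y₀ i <;> decide
  have hrm := bb_rmWeight_holds m 4 _ hdeg ⟨y₀, hD0⟩
  -- the non-fixed set contains the support of the degree-4 coordinate
  set Fx := univ.filter (fun y₂ : Fin m → Bool => y₂ = τ (π y₂)) with hFx
  set D := univ.filter (fun y : Fin m → Bool => (τ (π y) i ^^ y i) = true) with hD
  have hdisj : Disjoint Fx D := by
    rw [disjoint_left]
    intro y hyF hyD
    have h1 := (mem_filter.1 hyF).2
    have h2 := (mem_filter.1 hyD).2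
    rw [← h1] at h2
    revert h2; cases y i <;> decide
  have hcard : #Fx + #D ≤ 2 ^ m := by
    rw [← card_union_of_disjoint hdisj]
    exact (card_le_univ _).trans_eq (by rw [Fintype.card_fun, Fintype.card_bool, Fintype.card_fin])
  have hFx : (#Fx : ℝ) ≤ (2 : ℝ) ^ m * (15 / 16) := by
    have h1 : (2 : ℝ) ^ m ≤ 2 ^ 4 * #D := by exact_mod_cast hrm
    have h2 : (#Fx : ℝ) + #D ≤ 2 ^ m := by exact_mod_cast hcard
    nlinarith
  calc |forrelation f g| ≤ (#Fx : ℝ) / (2 : ℝ) ^ m := abs_forrelation_mmPair_le f g π τ h r hg hf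
    _ ≤ 15 / 16 := by
        rw [div_le_iff₀ (by positivity)]
        linarith

/-- **Dichotomy.** Under the same hypotheses, `Φ(f,g) > 15/16` forces `τ ∘ π = id` (pointwise). [this work] -/
theorem mg_mmPair_dichotomy (f g : (Fin (m + m) → Bool) → Bool) (π τ : (Fin m → Bool) → (Fin m → Bool))
    (h r : (Fin m → Bool) → Bool)
    (hg : ∀ y₁ y₂ : Fin m → Bool, signOf (g (Fin.append y₁ y₂)) = twist y₁ (π y₂) * signOf (h y₂))
    (hf : ∀ x₁ x₂ : Fin m → Bool, signOf (f (Fin.append x₁ x₂)) = twist x₂ (τ x₁) * signOf (r x₁))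
    (hπ : ∀ i, IsDegLeFun 2 (fun y => π y i)) (hτ : ∀ i, IsDegLeFun 2 (fun x => τ x i))
    (hΦ : (15 / 16 : ℝ) < forrelation f g) : ∀ y₂, τ (π y₂) = y₂ := by
  by_contra hne
  push Not at hne
  have := mg_mmPair_gap f g π τ h r hg hf hπ hτ hne
  have habs : forrelation f g ≤ |forrelation f g| := le_abs_self _
  linarith

/-- **Near-exact two-sided MM pairs are bijective with an explicit defect.** Under the same hypotheses, `Φ(f,g) > 15/16` implies
`Φ(f,g) = 2^{−m} Σ_y (−1)^{h(y) ⊕ r(π y)}` (`= 1 − 2·#{h ≠ r∘π}/2^m`); so inside this class `NearExactIsExact` reduces to the minimum weight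
of the non-zero words `h ⊕ r∘π` ("BQQ", settled for `m = 7` in `Negative/BqqSeven.lean`). [this work] -/
theorem mg_mmPair_near_exact (f g : (Fin (m + m) → Bool) → Bool) (π τ : (Fin m → Bool) → (Fin m → Bool))
    (h r : (Fin m → Bool) → Bool)
    (hg : ∀ y₁ y₂ : Fin m → Bool, signOf (g (Fin.append y₁ y₂)) = twist y₁ (π y₂) * signOf (h y₂))
    (hf : ∀ x₁ x₂ : Fin m → Bool, signOf (f (Fin.append x₁ x₂)) = twist x₂ (τ x₁) * signOf (r x₁))
    (hπ : ∀ i, IsDegLeFun 2 (fun y => π y i)) (hτ : ∀ i, IsDegLeFun 2 (fun x => τ x i))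
    (hΦ : (15 / 16 : ℝ) < forrelation f g) :
    forrelation f g = ((2 : ℝ) ^ m)⁻¹ * ∑ y₂ : Fin m → Bool, signOf (h y₂) * signOf (r (π y₂)) :=
  forrelation_mmPair_of_leftInverse f g π τ h r hg hf (mg_mmPair_dichotomy f g π τ h r hg hf hπ hτ hΦ)

/-- **Isolation with `θ = 31/32` on the whole two-sided quadratic Maiorana–McFarland class, at every `n`.**  If moreover the
offsets `h, r` are cubic (so `f, g` are cubic), then `Φ(f,g) = 1 ∨ Φ(f,g) ≤ 31/32`: either `τ∘π ≠ id` and `|Φ| ≤ 15/16`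
(`mg_mmPair_gap`), or `τ∘π = id` and `Φ = 1 − 2·wt(h ⊕ r∘π)/2^m` with `h ⊕ r∘π` of degree `≤ 6`, hence `≡ 0` (exact) or of weight
`≥ 2^{m−6}` (Reed–Muller).  So `NearExactIsExact` HOLDS, uniformly in `n`, for this structured class (which contains every record value
known in the tree); NOT a statement about all cubic pairs. [this work] -/
theorem mg_mmPair_isolation (f g : (Fin (m + m) → Bool) → Bool) (π τ : (Fin m → Bool) → (Fin m → Bool))
    (h r : (Fin m → Bool) → Bool)
    (hg : ∀ y₁ y₂ : Fin m → Bool, signOf (g (Fin.append y₁ y₂)) = twist y₁ (π y₂) * signOf (h y₂))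
    (hf : ∀ x₁ x₂ : Fin m → Bool, signOf (f (Fin.append x₁ x₂)) = twist x₂ (τ x₁) * signOf (r x₁))
    (hπ : ∀ i, IsDegLeFun 2 (fun y => π y i)) (hτ : ∀ i, IsDegLeFun 2 (fun x => τ x i))
    (hh : IsDegLeFun 3 h) (hr : IsDegLeFun 3 r) :
    forrelation f g = 1 ∨ forrelation f g ≤ 31 / 32 := by
  classical
  by_cases hne : ∃ y₂, τ (π y₂) ≠ y₂
  · right
    have := mg_mmPair_gap f g π τ h r hg hf hπ hτ hne
    have habs : forrelation f g ≤ |forrelation f g| := le_abs_self _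
    linarith
  · push Not at hne
    have hΦ := forrelation_mmPair_of_leftInverse f g π τ h r hg hf hne
    -- the defect word `h ⊕ r∘π` has degree `≤ 6`
    have hdeg : IsDegLeFun 6 (fun y => h y ^^ r (π y)) :=
      bb_isDegLeFun_bxor (hh.mono (by norm_num)) (fc_isDegLeFun_comp hr π hπ (by norm_num))
    have hsum : ∑ y₂ : Fin m → Bool, signOf (h y₂) * signOf (r (π y₂)) =
        (2 : ℝ) ^ m - 2 * ((univ.filter fun y : Fin m → Bool => (h y ^^ r (π y)) = true).card : ℝ) := by
      rw [← fc_sum_signOf_eq_card]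
      exact sum_congr rfl fun y _ => (signOf_xor _ _).symm
    by_cases hzero : ∃ y, (h y ^^ r (π y)) = true
    · right
      have hrm := bb_rmWeight_holds m 6 _ hdeg hzero
      have hrm' : (2 : ℝ) ^ m ≤ 2 ^ 6 * ((univ.filter fun y : Fin m → Bool => (h y ^^ r (π y)) = true).card : ℝ) := by
        exact_mod_cast hrm
      rw [hΦ, hsum]
      have h2 : (0 : ℝ) < 2 ^ m := by positivity
      rw [show ((2 : ℝ) ^ m)⁻¹ * (2 ^ m - 2 * ((univ.filter fun y : Fin m → Bool => (h y ^^ r (π y)) = true).card : ℝ)) =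
        1 - 2 * ((univ.filter fun y : Fin m → Bool => (h y ^^ r (π y)) = true).card : ℝ) / 2 ^ m by field_simp]
      have : 2 ^ m / 32 ≤ 2 * ((univ.filter fun y : Fin m → Bool => (h y ^^ r (π y)) = true).card : ℝ) := by linarith
      have hdiv : (1 : ℝ) / 32 ≤ 2 * ((univ.filter fun y : Fin m → Bool => (h y ^^ r (π y)) = true).card : ℝ) / 2 ^ m := by
        rw [le_div_iff₀ h2]; linarith
      linarith
    · left
      push Not at hzero
      have hcard : ((univ.filter fun y : Fin m → Bool => (h y ^^ r (π y)) = true).card : ℝ) = 0 := by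
        have : (univ.filter fun y : Fin m → Bool => (h y ^^ r (π y)) = true) = ∅ :=
          filter_eq_empty_iff.2 fun y _ => by simpa using hzero y
        rw [this, card_empty]; simp
      rw [hΦ, hsum, hcard]
      have h2 : (2 : ℝ) ^ m ≠ 0 := by positivity
      field_simp
      ring

end Summit.QuantumAdvantage.QuantumAdvantage.Theorems.CubicForrelation.NearExactIsExact

end
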